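import Mathlib
import HarnessLib
import Summits.Ventures.LatticeQCDFlow.Exactness.NCMCExpandedEnsemble
import Summits.Ventures.LatticeQCDFlow.Exactness.NCMCAcceptance

/-!
# The expanded-ensemble NCMC switch kernel is a Markov kernel (non-negative, unit row sums)

HONEST FRAMING: exact (Metropolis-corrected) sampling algorithms for lattice gauge theory;
figures of merit are autocorrelation/cost numbers at stated couplings and volumes; no
continuum-physics claim.

Venture `LatticeQCDFlow` (cell pub-lqcd), topic `Exactness`; FANOUT row 13 (`eng-snf`, GEN-8).
Companion of `Exactness/NCMCExpandedEnsemble.lean` (the `ncmc-metropolis` sampler of `latflow-snf`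
0.1.9: kernel `ncmcKernel c S P` on `Bool × X`, invariant law `ncmcWeight c S`, detailed balance for
every `c`).  NEW WORK of the cell (elementary finite sums); nothing is cited as a fact.

That file proves invariance and unit row sums with no hypothesis on the kernels beyond
stationarity; THIS file adds what makes `ncmcKernel` a genuine Markov kernel — non-negative
entries — i.e. that the accepted mass out of every state is at most one:

* `sum_transProb_from` — `Σ_ω [ω 0 = x] Π_k P k = 1` (row-stochastic forward kernels);
* `sum_revTransProb_to` — `Σ_ω [ω n = y] Π_k P̂ k = 1` for the REVERSED kernels, from STATIONARITY
  ALONE (Crooks `crooks_unnormalised` + `jarzynski_observable` with the indicator of `y`; no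
  reversibility and no row-stochasticity of the `P k` needed on this side);
* `sum_fwdSwitch_le_one`, `sum_revSwitch_le_one` (acceptances `≤ 1`), `ncmcMove_nonneg`,
  **`ncmcKernel_nonneg`**: with `ncmcKernel_sum_eq_one` and `ncmcKernel_isStationary` of the
  companion file, the expanded-ensemble chain of `snf.ncmc.run_ncmc_chain` is a bona fide Markov
  chain leaving `ncmcWeight c S` invariant, for every fixed `c`;
* the BRIDGE to row 8's acceptance functional (`Exactness/NCMCAcceptance.lean`):
  **`gibbs_fwdSwitch_eq_ncmcAccRate`** — at `c = ΔF` the stationary mean forward acceptance of the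
  sampler, `Σ_x gibbsLaw (S 0) x · Σ_y fwdSwitch ΔF S P x y`, IS `ncmcAccRate S P`
  (`= 1 − TV(P_F, P_R)` by `ncmcAccRate_eq_one_sub_tvDist`), and **`gibbs_revSwitch_eq_ncmcRevAccRate`**
  — the target-side twin is `ncmcRevAccRate S P` (equal to the forward one,
  `ncmcRevAccRate_eq_ncmcAccRate`): what the engine's `meta.acceptance_forward / _reverse` estimate
  at `c = ΔF` in stationarity.
-/

namespace Summit.Ventures.LatticeQCDFlow.Exactness

open Finset
open Literature.Probability.MarkovChains

variable {X : Type*} [Fintype X] [DecidableEq X] {n : ℕ}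

omit [Fintype X] [DecidableEq X] in
/-- Acceptances lie in `[0, 1]`. -/
theorem fwdAcc_mem (c : ℝ) (S : Fin (n + 1) → X → ℝ) (ω : Fin (n + 1) → X) :
    0 ≤ fwdAcc c S ω ∧ fwdAcc c S ω ≤ 1 :=
  ⟨le_min zero_le_one (Real.exp_pos _).le, min_le_left _ _⟩

omit [Fintype X] [DecidableEq X] in
/-- Acceptances lie in `[0, 1]`. -/
theorem revAcc_mem (c : ℝ) (S : Fin (n + 1) → X → ℝ) (ω : Fin (n + 1) → X) :
    0 ≤ revAcc c S ω ∧ revAcc c S ω ≤ 1 :=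
  ⟨le_min zero_le_one (Real.exp_pos _).le, min_le_left _ _⟩

/-- Total forward proposal probability from `x` is one (row-stochastic kernels):
`Σ_ω [ω 0 = x] Π P(ω) = 1`. -/
theorem sum_transProb_from (P : Fin n → X → X → ℝ) (hP : ∀ k x, ∑ y, P k x y = 1) (x : X) :
    ∑ ω : Fin (n + 1) → X, (if ω 0 = x then transProb P ω else 0) = 1 := by
  have h := sum_pathLaw (fun x' => if x' = x then (1 : ℝ) else 0) P hP
  rw [sum_ite_eq' univ x, if_pos (mem_univ x)] at h
  rw [← h]
  refine sum_congr rfl fun ω _ => ?_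
  unfold pathLaw
  by_cases h0 : ω 0 = x
  · simp only [h0, if_true, one_mul]
  · simp only [h0, if_false, zero_mul]

/-- Total REVERSE proposal probability into the pinned end `y` is one, from STATIONARITY alone:
`Σ_ω [ω n = y] Π P̂(ω) = 1` (Crooks + `jarzynski_observable` with the indicator of `y`). -/
theorem sum_revTransProb_to [Nonempty X] (S : Fin (n + 1) → X → ℝ) (P : Fin n → X → X → ℝ)
    (hP : ∀ k : Fin n, IsStationary (fun x => Real.exp (-S k.succ x)) (P k)) (y : X) :
    ∑ ω : Fin (n + 1) → X, (if ω (Fin.last n) = y then revTransProb S P ω else 0) = 1 := by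
  have hJ := jarzynski_observable S P hP (fun z => if z = y then Real.exp (S (Fin.last n) y) else 0)
  simp only [mul_ite, mul_zero, Finset.sum_ite_eq', Finset.mem_univ, if_true] at hJ
  rw [← Real.exp_add, neg_add_cancel, Real.exp_zero] at hJ
  rw [← hJ]
  refine sum_congr rfl fun ω _ => ?_
  by_cases h : ω (Fin.last n) = y
  · rw [if_pos h, if_pos h, crooks_unnormalised S P ω, h, mul_comm (Real.exp (-S (Fin.last n) y)),
      mul_assoc, ← Real.exp_add, neg_add_cancel, Real.exp_zero, mul_one]
  · rw [if_neg h, if_neg h]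

/-- The accepted forward mass out of `x` is at most one. -/
theorem sum_fwdSwitch_le_one (c : ℝ) (S : Fin (n + 1) → X → ℝ) (P : Fin n → X → X → ℝ)
    (hP0 : ∀ k x y, 0 ≤ P k x y) (hP1 : ∀ k x, ∑ y, P k x y = 1) (x : X) :
    ∑ y, fwdSwitch c S P x y ≤ 1 := by
  calc ∑ y, fwdSwitch c S P x y
      = ∑ ω : Fin (n + 1) → X, (if ω 0 = x then transProb P ω * fwdAcc c S ω else 0) := by
        unfold fwdSwitch
        rw [sum_comm]
        refine sum_congr rfl fun ω _ => ?_
        by_cases h0 : ω 0 = x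
        · rw [if_pos h0]
          simp only [h0, true_and]
          rw [sum_ite_eq univ (ω (Fin.last n)), if_pos (mem_univ _)]
        · rw [if_neg h0]
          exact sum_eq_zero fun y _ => if_neg fun h => h0 h.1
    _ ≤ ∑ ω : Fin (n + 1) → X, (if ω 0 = x then transProb P ω else 0) := by
        refine sum_le_sum fun ω _ => ?_
        split_ifs
        · have hT : 0 ≤ transProb P ω := prod_nonneg fun k _ => hP0 k _ _
          calc transProb P ω * fwdAcc c S ω ≤ transProb P ω * 1 :=
                mul_le_mul_of_nonneg_left (fwdAcc_mem c S ω).2 hT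
            _ = transProb P ω := mul_one _
        · exact le_rfl
    _ = 1 := sum_transProb_from P hP1 x

/-- The accepted reverse mass out of `y` is at most one (positive, stationary kernels). -/
theorem sum_revSwitch_le_one [Nonempty X] (c : ℝ) (S : Fin (n + 1) → X → ℝ)
    (P : Fin n → X → X → ℝ) (hP0 : ∀ k x y, 0 ≤ P k x y)
    (hP : ∀ k : Fin n, IsStationary (fun x => Real.exp (-S k.succ x)) (P k)) (y : X) :
    ∑ x, revSwitch c S P y x ≤ 1 := by
  have hR : ∀ ω : Fin (n + 1) → X, 0 ≤ revTransProb S P ω := fun ω =>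
    prod_nonneg fun k _ => Theory2.revKernel_nonneg (fun _ => Real.exp_pos _) (hP0 k) _ _
  calc ∑ x, revSwitch c S P y x
      = ∑ ω : Fin (n + 1) → X,
          (if ω (Fin.last n) = y then revTransProb S P ω * revAcc c S ω else 0) := by
        unfold revSwitch
        rw [sum_comm]
        refine sum_congr rfl fun ω _ => ?_
        by_cases hn : ω (Fin.last n) = y
        · rw [if_pos hn]
          simp only [hn, and_true]
          rw [sum_ite_eq univ (ω 0), if_pos (mem_univ _)]
        · rw [if_neg hn]
          exact sum_eq_zero fun x _ => if_neg fun h => hn h.2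
    _ ≤ ∑ ω : Fin (n + 1) → X, (if ω (Fin.last n) = y then revTransProb S P ω else 0) := by
        refine sum_le_sum fun ω _ => ?_
        split_ifs
        · calc revTransProb S P ω * revAcc c S ω ≤ revTransProb S P ω * 1 :=
                mul_le_mul_of_nonneg_left (revAcc_mem c S ω).2 (hR ω)
            _ = revTransProb S P ω := mul_one _
        · exact le_rfl
    _ = 1 := sum_revTransProb_to S P hP y

/-- Accepted-move weights are non-negative (non-negative kernels). -/
theorem ncmcMove_nonneg [Nonempty X] (c : ℝ) (S : Fin (n + 1) → X → ℝ) (P : Fin n → X → X → ℝ)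
    (hP0 : ∀ k x y, 0 ≤ P k x y) (s s' : Bool × X) : 0 ≤ ncmcMove c S P s s' := by
  have hT : ∀ ω : Fin (n + 1) → X, 0 ≤ transProb P ω := fun ω => prod_nonneg fun k _ => hP0 k _ _
  have hR : ∀ ω : Fin (n + 1) → X, 0 ≤ revTransProb S P ω := fun ω =>
    prod_nonneg fun k _ => Theory2.revKernel_nonneg (fun _ => Real.exp_pos _) (hP0 k) _ _
  rcases s with ⟨b, x⟩
  rcases s' with ⟨b', y⟩
  cases b <;> cases b' <;> simp only [ncmcMove]
  · exact le_rfl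
  · exact sum_nonneg fun ω _ => by
      split_ifs
      · exact mul_nonneg (hT ω) (fwdAcc_mem c S ω).1
      · exact le_rfl
  · exact sum_nonneg fun ω _ => by
      split_ifs
      · exact mul_nonneg (hR ω) (revAcc_mem c S ω).1
      · exact le_rfl
  · exact le_rfl

/-- **The switch kernel is a Markov kernel**: non-negative entries (and unit row sums,
`ncmcKernel_sum_eq_one`) for non-negative, row-stochastic kernels each stationary for its own
Boltzmann weight. -/
theorem ncmcKernel_nonneg [Nonempty X] (c : ℝ) (S : Fin (n + 1) → X → ℝ) (P : Fin n → X → X → ℝ)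
    (hP0 : ∀ k x y, 0 ≤ P k x y) (hP1 : ∀ k x, ∑ y, P k x y = 1)
    (hP : ∀ k : Fin n, IsStationary (fun x => Real.exp (-S k.succ x)) (P k)) (s s' : Bool × X) :
    0 ≤ ncmcKernel c S P s s' := by
  unfold ncmcKernel
  have hm := ncmcMove_nonneg c S P hP0 s s'
  split_ifs with h
  · subst h
    have hrow : ∑ t, ncmcMove c S P s' t ≤ 1 := by
      rcases s' with ⟨b, x⟩
      rw [Fintype.sum_prod_type, Fintype.sum_bool]
      cases b
      · simp only [ncmcMove, sum_const_zero, add_zero]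
        exact sum_fwdSwitch_le_one c S P hP0 hP1 x
      · simp only [ncmcMove, sum_const_zero, zero_add]
        exact sum_revSwitch_le_one c S P hP0 hP x
    linarith
  · rw [add_zero]
    exact hm


/-! ## Bridge to the acceptance functional of `NCMCAcceptance.lean` -/

/-- Summing the accepted forward weight against any start law gives the path-space average of the
acceptance: `Σ_x μ x · Σ_y F_c(x → y) = Σ_ω pathLaw μ P ω · min 1 e^{-(W(ω) − c)}`. -/
theorem sum_mul_fwdSwitch (c : ℝ) (S : Fin (n + 1) → X → ℝ) (P : Fin n → X → X → ℝ) (μ : X → ℝ) :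
    ∑ x, μ x * ∑ y, fwdSwitch c S P x y =
      ∑ ω : Fin (n + 1) → X, pathLaw μ P ω * fwdAcc c S ω := by
  calc ∑ x, μ x * ∑ y, fwdSwitch c S P x y
      = ∑ x, ∑ ω : Fin (n + 1) → X, (if ω 0 = x then μ x * (transProb P ω * fwdAcc c S ω) else 0) := by
        refine sum_congr rfl fun x _ => ?_
        unfold fwdSwitch
        rw [sum_comm, mul_sum]
        refine sum_congr rfl fun ω _ => ?_
        by_cases h0 : ω 0 = x
        · rw [if_pos h0]
          simp only [h0, true_and]
          rw [sum_ite_eq univ (ω (Fin.last n)), if_pos (mem_univ _)]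
        · rw [if_neg h0]
          rw [sum_eq_zero fun y _ => if_neg fun h => h0 h.1, mul_zero]
    _ = ∑ ω : Fin (n + 1) → X, ∑ x, (if ω 0 = x then μ x * (transProb P ω * fwdAcc c S ω) else 0) :=
        sum_comm
    _ = ∑ ω : Fin (n + 1) → X, pathLaw μ P ω * fwdAcc c S ω := by
        refine sum_congr rfl fun ω _ => ?_
        rw [sum_ite_eq univ (ω 0), if_pos (mem_univ _)]
        unfold pathLaw
        ring

/-- The same for the reverse move against any end law:
`Σ_y ν y · Σ_x R_c(y → x) = Σ_ω ν (ω n) · Π P̂(ω) · min 1 e^{W(ω) − c}`. -/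
theorem sum_mul_revSwitch (c : ℝ) (S : Fin (n + 1) → X → ℝ) (P : Fin n → X → X → ℝ) (ν : X → ℝ) :
    ∑ y, ν y * ∑ x, revSwitch c S P y x =
      ∑ ω : Fin (n + 1) → X, ν (ω (Fin.last n)) * revTransProb S P ω * revAcc c S ω := by
  calc ∑ y, ν y * ∑ x, revSwitch c S P y x
      = ∑ y, ∑ ω : Fin (n + 1) → X,
          (if ω (Fin.last n) = y then ν y * (revTransProb S P ω * revAcc c S ω) else 0) := by
        refine sum_congr rfl fun y _ => ?_
        unfold revSwitch
        rw [sum_comm, mul_sum]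
        refine sum_congr rfl fun ω _ => ?_
        by_cases hn : ω (Fin.last n) = y
        · rw [if_pos hn]
          simp only [hn, and_true]
          rw [sum_ite_eq univ (ω 0), if_pos (mem_univ _)]
        · rw [if_neg hn]
          rw [sum_eq_zero fun x _ => if_neg fun h => hn h.2, mul_zero]
    _ = ∑ ω : Fin (n + 1) → X, ∑ y,
          (if ω (Fin.last n) = y then ν y * (revTransProb S P ω * revAcc c S ω) else 0) := sum_comm
    _ = ∑ ω : Fin (n + 1) → X, ν (ω (Fin.last n)) * revTransProb S P ω * revAcc c S ω := by
        refine sum_congr rfl fun ω _ => ?_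
        rw [sum_ite_eq univ (ω (Fin.last n)), if_pos (mem_univ _)]
        ring

/-- **Bridge (forward).**  At `c = ΔF = freeEnergy (S n) − freeEnergy (S 0)` the stationary mean
forward acceptance of the sampler (prior level in equilibrium) is row 8's `ncmcAccRate S P`
(hence `= 1 − TV(P_F, P_R)` by `ncmcAccRate_eq_one_sub_tvDist`). -/
theorem gibbs_fwdSwitch_eq_ncmcAccRate (S : Fin (n + 1) → X → ℝ) (P : Fin n → X → X → ℝ) :
    ∑ x, gibbsLaw (S 0) x *
        ∑ y, fwdSwitch (freeEnergy (S (Fin.last n)) - freeEnergy (S 0)) S P x y =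
      ncmcAccRate S P := by
  rw [sum_mul_fwdSwitch]
  rfl

/-- **Bridge (reverse).**  At `c = ΔF` the stationary mean reverse acceptance (target level in
equilibrium) is row 8's `ncmcRevAccRate S P` — equal to the forward one by
`ncmcRevAccRate_eq_ncmcAccRate`: the engine's `acceptance_forward` and `acceptance_reverse`
estimate the same number at `c = ΔF`. -/
theorem gibbs_revSwitch_eq_ncmcRevAccRate [Nonempty X] (S : Fin (n + 1) → X → ℝ)
    (P : Fin n → X → X → ℝ) :
    ∑ y, gibbsLaw (S (Fin.last n)) y *
        ∑ x, revSwitch (freeEnergy (S (Fin.last n)) - freeEnergy (S 0)) S P y x =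
      ncmcRevAccRate S P := by
  rw [sum_mul_revSwitch]
  unfold ncmcRevAccRate
  refine sum_congr rfl fun ω _ => ?_
  rw [revPathLaw_eq]
  rfl

end Summit.Ventures.LatticeQCDFlow.Exactness
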